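import Literature.MathematicalPhysics.QuantumFieldTheory.Balaban1983to89.B9Eq340ProbeBridgeSNtoKA
import Literature.MathematicalPhysics.QuantumFieldTheory.Balaban1983to89.B9RWSumsDefinitePinsPairMDir

/-!
# `Balaban1983to89.B9HpDGWFromPinsSN` — T. Bałaban, *Propagators for lattice gauge theories in a background field*, Commun. Math. Phys. **99** (1985) 389–434
# [Balaban1985BackgroundPropagators], (3.43)₁ p. 398 «‖ζ∇_UG′(U)λ‖_β ≦ B₀(β)(Lʲη)^{1−β}e^{−δ₀d(y,y′)}|λ|» AT THE N06 CERTIFICATE's BOND PROBE PIN: the displayed rows-20–21 binder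
# `hpDGW` (the (3.43) probe member of `Φ^X_β ∘ D_U ∘ G′`) ASSEMBLED from the rows-18 data — Theorem 3.7's local legs at the NEAR site carrier, the leaf `B9.Thm37Printed`, print's class
# (3.35) — through n06-k's Hölder sum, this lineage's transporter change and the probe carrier bridge

[4] = T. Bałaban, *Propagators and renormalization transformations for lattice gauge theories. II*, Commun. Math. Phys. **96** (1984) 223–250 [`Balaban1984PropagatorsII`].
statement-level skeleton of published theorems with citation tags; proofs where landed; nothing here is a claim about the Yang–Mills mass gap.

THE PRINT.  Thm 3.7 p. 409 + «Theorem 3.7 implies (3.42)–(3.47)» p. 410; Thm 3.1 (3.42)₂, (3.43)₁ pp. 397–398; (3.40) p. 397 («a shortest contour»); (3.35) p. 396 with (3.69) p. 404.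

WHY THIS FILE (cell `pub-ymgap`, node N06 [B9], seat `pub-ymgap-dag-n06-c` g19; the G′ Hölder layer of rows 20–21, dag-n06-d `DISPLAY-LEDGER-UF.md` §2 binder `hpDGW`; road memo
`pub-ymgap-dag-n06-c/HPDGW-ROAD.md`).  The pattern of dag-n06-l's `B9Thm31GpMajFromPinsPairMR.thm31GpMaj_of_thm37PrintedR` (rows 20–21's SUP members from rows 18's leaf), for
the first HÖLDER member: per member and configuration, n06-k's `B9RWSums343HolderGpDir.holder343_of_local37_dir` gives the left (3.43) member of the sum `G′(U)` at the site probe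
family `𝔭 x` — here the NEAR carrier `holderProbesSN … parSymY` —, `B9Thm312WholeClasses.hasMaj_cNormR_of_hasMajorantHom` moves it to the `𝔠` classes,
`B9Eq340ProbeTransferSNY.hasMaj_probesSN_parSY_of_parSymY` changes the table to `parSY = taxiS` under print's (3.35), and
`B9Eq340ProbeBridgeSNtoKA.hasMaj_probesKA_DvGcoS_of_probesSN` reads the result on the BOND probe family `holderProbesKA … parBY` of `D_U ∘ G′` — the displayed shape.
* ★★★ `hpDGW_of_thm37PrintedSN` — for an operator record `𝔬 x` with the site pins (`blk = blkY = blkSK (sIK bI)`, `Gp = GcoS … O`, `D = DcoS`), the near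
  site probe pin `𝔭 x = holderProbesSN … (parSymY x.toKIdx) (bI x)`, static data `StaticOK ∕ Sizes.Bounded ∕ hcntH`, Theorem 3.7's local inputs (`Local342 ∧ DirSupSq37 ∧ Identities₂ ∧
  HolderLegs37 ∧ HolderV37Dir` for `M ≥ M₁`, `c·M·α₀ ≤ a₁`, (3.35)), a leaf `B9.Thm37Printed c geo9Y bg E` whose convergence projects to `Conv342 (𝔬 x) 1 (H x) C δ`
  (`0 ≤ δ ≤ (1−α)δ₀`), and print's class read off `(bg x).Reg335` (`hP`): there are `M₂, a₀ > 0` such that for every member above them, every regular `U` and every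
  `β′ ∈ [0,1)`, `HasMaj 𝔠⁽⁰⁾_{blkSK(sIK bI)} 𝔠_P^{(β′−1)}_{blkPK bI} ((holderProbesKA … (parBY x.toKIdx) (bI x)).ΦX U β′ ∘ₗ (DvcoKH … U ∘ₗ GcoS … (O x) U)) (BhW(a₀, β′)·e^{−δd})` with
  the CLOSED, member-independent constant `BhW(a₀, β′)` (`|cf|·η = 1` and `L = ℓ+1` are used to read it off).
HONEST SCOPE.  An assembler over landed theorems; Theorem 3.7's local legs, the leaf and print's class are HYPOTHESES (the certificate's displayed rows-18 binders after the
re-pin to the near carrier); nothing of [B9] asserted; no certificate edition written; COUNT-NEUTRAL; N06 NOT discharged; nothing continuum, nothing about the mass gap.  Cell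
`pub-ymgap` (HUMAN RULING D-0062), Track A node N06 [B9], seat `pub-ymgap-dag-n06-c` (g19), 2026-08-29; a NEW file; 0 `def`, no `sorry`, no `axiom`, no `instance`, no `notation`.
-/

noncomputable section

namespace Literature.MathematicalPhysics.QuantumFieldTheory.Balaban1983to89.B9HpDGWFromPinsSN

open B6RandomWalk (HasMajorant c1_nonneg Ineq261)
open B6RandomWalkHom (HasMajorantHom hasMajorantHom_mono)
open B6GlobalChartV1 (PV blkV1)
open B6Geom246MultiLevelTorus (geomT)
open B6Ineq2142KLevelV1 (lvl β)
open B6KLevelCensusIndexV1 (KIdx kGeo)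
open B6Prop22KLevelTorusCensusEta (nKT nKT_pos)
open B9Thm34Ext (toB6)
open B9Thm37Whole (Ops Conv342 Sizes StaticOK Local342)
open B9RWSums346SecondDiffGp (DirOps37)
open B9Thm37WholeDir (DirLetters37 DirSupSq37 Identities₂)
open B9Thm37KLetterDir (HolderV37Dir)
open B9RWSums343Holder (HolderProbes holderConst)
open B9RWSums343HolderGp (HolderLegs37)
open B9RWSums343HolderGpDir (holder343_of_local37_dir)
open B9RWSums347DefiniteFaces (exp261 lemma21Pack_geo9Y)
open B9GeoLemma21KLevelV1 (geo9Y_len_pos geo9Y_dist_triangle geo9Y_dist_comm)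
open B9GeoNormsKLevelV1 (geo9K geo9K_dist_nonneg)
open B9PinMembersKLevelV1 (MemberY geo9Y)
open B9Thm39ReadingCoords (coordBound39 basisBound39)
open B9CoReadingCoordsS (XSK blkSK sIK GcoS DcoS)
open B9CoReadingCoordsHolder (PK blkPK)
open B9CoReadingCoordsHolderAdm (holderProbesKA)
open B9CoReadingCoordsHolderSNear (holderProbesSN)
open B9BackgroundsKLevelV1P (bg9KP)
open Node00 (SiteY FBondY IBondY CfgY SiteOpY parSymY parSY parBY toKT etaS)
open Node00.OpsYSectDCoords (DvcoKH)
open B9Eq340ProbeTransferSNY (hasMaj_probesSN_parSY_of_parSymY)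
open B9Eq340ProbeBridgeSNtoKA (hasMaj_probesKA_DvGcoS_of_probesSN)
open B9Thm312Whole (GeoOK)
open B9Thm312WholeClasses (cNormR hasMaj_cNormR_of_hasMajorantHom)
open T4RelativeLadder (UnitaryLike)
open B11SectG (HasMaj)
open scoped Matrix.Norms.L2Operator

variable {d ℓ : ℕ} {hd : 1 ≤ d + 1} {hL : Odd (ℓ + 1) ∧ 1 < ℓ + 1} {b₀ b₁ : ℝ} {Mstar : ℕ}
variable {N : ℕ} [Nonempty (Fin N)] {κ : Type} [Fintype κ] [DecidableEq κ]
variable [∀ x : MemberY d ℓ hd hL b₀ b₁ Mstar, Fintype (geo9Y x).Site] [∀ x : MemberY d ℓ hd hL b₀ b₁ Mstar, DecidableEq (geo9Y x).Site]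

/-- Arithmetic of «for M sufficiently large» (the siblings' private lemma): `s ≦ θ₀M⁻¹` and `M ≧ 2N′B₀e^{δ₀ρ}θ₀c₁` give `N′B₀e^{δ₀ρ}sc₁ ≦ ½`. [folklore] -/
private theorem small_of_size_pair {N' B₀ ex s θ₀ c M : ℝ} (hN' : 0 ≤ N') (hB : 0 ≤ B₀ * ex) (hc : 0 ≤ c) (hM : 0 < M)
    (hs : s ≤ θ₀ * M⁻¹) (hbig : 2 * N' * (B₀ * ex * θ₀) * c ≤ M) : N' * (B₀ * ex * s) * c ≤ 1 / 2 := by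
  have h1 : N' * (B₀ * ex * s) * c ≤ N' * (B₀ * ex * (θ₀ * M⁻¹)) * c :=
    mul_le_mul_of_nonneg_right (mul_le_mul_of_nonneg_left (mul_le_mul_of_nonneg_left hs hB) hN') hc
  have h2 : N' * (B₀ * ex * (θ₀ * M⁻¹)) * c = (N' * (B₀ * ex * θ₀) * c) / M := by
    rw [div_eq_mul_inv]; ring
  rw [h2] at h1
  refine h1.trans ?_
  rw [div_le_iff₀ hM]
  linarith

/-- the Hölder constant is ≧ 0 for nonnegative letters (the engine's private lemma). [folklore] -/
private theorem holderConst_nonneg' {dd : ℕ} {δ₀ α NH NF C b t : ℝ} (hNH : 0 ≤ NH) (hNF : 0 ≤ NF) (hC : 0 ≤ C) (hb : 0 ≤ b)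
    (ht : 0 ≤ t) : 0 ≤ holderConst dd δ₀ α NH NF C b t := by
  have hc1 : 0 ≤ B6.c1 dd δ₀ α := c1_nonneg dd δ₀ α
  unfold holderConst
  positivity

omit [Nonempty (Fin N)] [Fintype κ] [DecidableEq κ] [∀ x : MemberY d ℓ hd hL b₀ b₁ Mstar, Fintype (geo9Y x).Site]
  [∀ x : MemberY d ℓ hd hL b₀ b₁ Mstar, DecidableEq (geo9Y x).Site] in
/-- the record geometry is a `GeoOK` geometry. [cite: Balaban1984PropagatorsII, (2.46)–(2.47) p.231, bookkeeping] -/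
private theorem geoOK_geo9Y (x : MemberY d ℓ hd hL b₀ b₁ Mstar) : GeoOK (geo9K x.toKIdx) :=
  ⟨geo9Y_dist_triangle x, geo9Y_dist_comm x, geo9K_dist_nonneg x.toKIdx, geo9Y_len_pos x⟩

/-- ★★★ **`hpDGW` FROM THE ROWS-18 DATA AT THE NEAR SITE CARRIER.**  See the module docstring: engine (n06-k) → currency → transporter change (print's (3.35)) → probe
carrier bridge; the constant `BhW(a₀, β′)` is closed in the displayed primitives (`holderConst … (Bl β′) (BV β′)`, the leaf's `C`, `K_pl(10·L·a₀)`, `c_b, b_b` of the basis) and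
the rate is the leaf's `δ`. [cite: Balaban1985BackgroundPropagators, Thm 3.7 p.409 + «Theorem 3.7 implies (3.42)–(3.47)» p.410 + (3.43) p.398 + (3.40) p.397 + (3.35) p.396] -/
theorem hpDGW_of_thm37PrintedSN {G : Subgroup (Matrix (Fin N) (Fin N) ℂ)ˣ} (hG1 : ∀ u : (Matrix (Fin N) (Fin N) ℂ)ˣ, u ∈ G → ‖(u : Matrix (Fin N) (Fin N) ℂ)‖ ≤ 1)
    {bg : MemberY d ℓ hd hL b₀ b₁ Mstar → B9.Backgrounds} (cfg : ∀ x : MemberY d ℓ hd hL b₀ b₁ Mstar, (bg x).Cfg → CfgY (Matrix (Fin N) (Fin N) ℂ) x.toKIdx)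
    (b : Module.Basis κ ℝ (Matrix (Fin N) (Fin N) ℂ)) {c35 c10 : ℝ} (hc10 : c10 ≤ 10)
    (hP : ∀ (x : MemberY d ℓ hd hL b₀ b₁ Mstar) (α₀ : ℝ) (U : (bg x).Cfg), (bg x).Reg335 c35 α₀ U →
      (bg9KP (Matrix (Fin N) (Fin N) ℂ) G x.toKIdx).Reg335 c10 α₀ (cfg x U))
    {ι Q : MemberY d ℓ hd hL b₀ b₁ Mstar → Type} [∀ x, Fintype (ι x)] [∀ x, Fintype (Q x)]
    (𝔬 : ∀ x : MemberY d ℓ hd hL b₀ b₁ Mstar, Ops (geo9Y x) (bg x) (XSK κ x.toKIdx) (XSK κ x.toKIdx) (ι x))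
    (𝔡 : ∀ x : MemberY d ℓ hd hL b₀ b₁ Mstar, DirOps37 (𝔬 x) (Q x)) (𝔩 : ∀ x : MemberY d ℓ hd hL b₀ b₁ Mstar, DirLetters37 (𝔬 x) (Q x))
    (𝔭 : ∀ x : MemberY d ℓ hd hL b₀ b₁ Mstar,
      HolderProbes (geo9Y x) (bg x) (XSK κ x.toKIdx) (XSK κ x.toKIdx) (PK (SiteY x.toKIdx) (Fin (d + 1)) κ) (PK (SiteY x.toKIdx) (Fin (d + 1)) κ))
    (H : MemberY d ℓ hd hL b₀ b₁ Mstar → Prop) (O : ∀ x : MemberY d ℓ hd hL b₀ b₁ Mstar, SiteOpY (Matrix (Fin N) (Fin N) ℂ) x.toKIdx)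
    {bI : ∀ x : MemberY d ℓ hd hL b₀ b₁ Mstar, FBondY x.toKIdx → IBondY x.toKIdx}
    (hlev : ∀ (x : MemberY d ℓ hd hL b₀ b₁ Mstar) (f : FBondY x.toKIdx), lvl x.toKIdx.hN x.toKIdx.D x.toKIdx.hk (bI x f) = (blkV1 x.toKIdx.hN x.toKIdx.D f).1.1)
    (hβ1 : ∀ (x : MemberY d ℓ hd hL b₀ b₁ Mstar) (f : FBondY x.toKIdx),
      (geomT x.toKIdx.D).dist (β x.toKIdx.hN x.toKIdx.D x.toKIdx.hk (bI x f)) (blkV1 x.toKIdx.hN x.toKIdx.D f) ≤ 1)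
    (hbI0 : ∀ (x : MemberY d ℓ hd hL b₀ b₁ Mstar) (f : FBondY x.toKIdx), bI x f = bI x ⟨f.src, 0⟩)
    (hcf : ∀ x : MemberY d ℓ hd hL b₀ b₁ Mstar, |x.toKIdx.cf| = (nKT (toKT x.toKIdx) : ℝ))
    (h𝔭 : ∀ x : MemberY d ℓ hd hL b₀ b₁ Mstar, 𝔭 x = holderProbesSN x.toKIdx b (bg x) (cfg x) (parSymY x.toKIdx) (bI x))
    (hblk : ∀ x : MemberY d ℓ hd hL b₀ b₁ Mstar, (𝔬 x).blk = blkSK x.toKIdx (sIK x.toKIdx (bI x)))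
    (hblkY : ∀ x : MemberY d ℓ hd hL b₀ b₁ Mstar, (𝔬 x).blkY = blkSK x.toKIdx (sIK x.toKIdx (bI x)))
    (hGp : ∀ (x : MemberY d ℓ hd hL b₀ b₁ Mstar) (U : (bg x).Cfg), (𝔬 x).Gp U = GcoS x.toKIdx b (bg x) (cfg x) (O x) U)
    (hD : ∀ (x : MemberY d ℓ hd hL b₀ b₁ Mstar) (U : (bg x).Cfg), (𝔬 x).D U = DcoS x.toKIdx b (bg x) (cfg x) U)
    (κS : MemberY d ℓ hd hL b₀ b₁ Mstar → Sizes) (SH : ∀ x : MemberY d ℓ hd hL b₀ b₁ Mstar, ι x → Finset (geo9Y x).Site)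
    {α ρ Nn N' Cℓ Kc θ₀ B₀ δ₀ a₁ M₁ NH αF C δ : ℝ} (Bl BV : ℝ → ℝ)
    (hc : 0 < c35) (hα : 0 < α) (hα2 : α < 1 / 2) (hN' : 0 ≤ N') (hNH : 0 ≤ NH) (hB₀ : 0 < B₀) (hδ₀ : 0 < δ₀) (ha₁ : 0 < a₁) (hM₁ : 0 < M₁)
    (hαF : 0 < αF) (hαF1 : αF < 1) (hC : 0 ≤ C) (hδnn : 0 ≤ δ) (hδle : δ ≤ (1 - α) * δ₀)
    (hBl : ∀ β', 0 ≤ β' → β' < 1 → 0 ≤ Bl β') (hBV : ∀ β', 0 ≤ β' → β' < 1 → 0 ≤ BV β')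
    (hst : ∀ x, StaticOK (𝔬 x) ρ Nn N' Cℓ (κS x)) (hκ : ∀ x, (κS x).Bounded Kc θ₀ Cℓ (geo9Y x).M)
    (hcntH : ∀ x (a : (geo9Y x).Site), (∑ q, if a ∈ SH x q then (1 : ℝ) else 0) ≤ NH)
    (hop : ∀ x, M₁ ≤ (geo9Y x).M → ∀ α₀ : ℝ, 0 < α₀ → c35 * (geo9Y x).M * α₀ ≤ a₁ →
      ∀ U : (bg x).Cfg, (bg x).Reg335 c35 α₀ U →
        Local342 (𝔬 x) 1 (H x) B₀ δ₀ U ∧ DirSupSq37 (𝔬 x) (𝔡 x) 1 (H x) U ∧ Identities₂ (𝔬 x) (𝔡 x) (𝔩 x) 1 (H x) U ∧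
          HolderLegs37 (𝔬 x) (𝔭 x) 1 (H x) (SH x) Bl δ₀ U ∧ HolderV37Dir (𝔬 x) (𝔡 x) (𝔩 x) (𝔭 x) 1 (H x) BV δ₀ U)
    (E : ∀ x : MemberY d ℓ hd hL b₀ b₁ Mstar, B9.RWExpansion (geo9Y x) (bg x)) (t37 : B9.Thm37Printed c35 (fun x => geo9Y x) bg E)
    (hconv : ∀ (x : MemberY d ℓ hd hL b₀ b₁ Mstar) (U : (bg x).Cfg), (E x).Converges U → Conv342 (𝔬 x) 1 (H x) C δ U) :
    ∃ M₂ a₀ : ℝ, 0 < M₂ ∧ 0 < a₀ ∧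
      ∀ x : MemberY d ℓ hd hL b₀ b₁ Mstar, letI : Fintype (geo9K x.toKIdx).Site := (inferInstance : Fintype (geo9Y x).Site)
        M₂ ≤ (geo9Y x).M → ∀ α₀ : ℝ, 0 < α₀ → (geo9Y x).M * α₀ ≤ a₀ →
        ∀ U : (bg x).Cfg, (bg x).Reg335 c35 α₀ U → ∀ β' : ℝ, 0 ≤ β' → β' < 1 →
          HasMaj (cNormR 1 (H x) (blkSK x.toKIdx (sIK x.toKIdx (bI x))) (geoOK_geo9Y x).lenle 0)
            (cNormR 1 (H x) (blkPK (bI x)) (geoOK_geo9Y x).lenle (β' - 1))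
            ((holderProbesKA x.toKIdx b (bg x) (cfg x) (parBY x.toKIdx) (bI x)).ΦX U β' ∘ₗ
              (DvcoKH x.toKIdx b (bg x) (cfg x) U ∘ₗ GcoS x.toKIdx b (bg x) (cfg x) (O x) U))
            (fun a a' =>
              ((holderConst (exp261 (@geo9Y d ℓ hd hL b₀ b₁ Mstar) δ₀ α) δ₀ α NH N' C (Bl β') (BV β') +
                  2 * coordBound39 b * basisBound39 b * ((ℓ : ℝ) + 1) * Real.exp (δ * (((d : ℝ) + 1) * (((ℓ : ℝ) + 1) + 1) + 2)) *
                    ((((d + 1 : ℕ) : ℝ)) ^ 2 * (2 * (10 * ((ℓ + 1 : ℕ) : ℝ) * a₀) * (1 + 10 * ((ℓ + 1 : ℕ) : ℝ) * a₀) *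
                      Real.exp (4 * (10 * ((ℓ + 1 : ℕ) : ℝ) * a₀))) * ((ℓ + 1 : ℕ) : ℝ) ^ 6) * C +
                  coordBound39 b * basisBound39 b * C + C) + C + coordBound39 b * basisBound39 b * C) *
              Real.exp (-(δ * (geo9Y x).dist a a'))) := by
  classical
  -- the leaf's thresholds and the record's (2.61) threshold
  obtain ⟨M₂, a₂, hM₂, ha₂, h37⟩ := t37
  obtain ⟨Mth, h261, -, -⟩ := lemma21Pack_geo9Y (d := d) (ℓ := ℓ) (hd := hd) (hL := hL) (b₀ := b₀) (b₁ := b₁) (Mstar := Mstar) H hα hα2 hδ₀ hαF hαF1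
  set dE : ℕ := exp261 (@geo9Y d ℓ hd hL b₀ b₁ Mstar) δ₀ α with hdE
  have hc1 : 0 ≤ B6.c1 dE δ₀ α := c1_nonneg dE δ₀ α
  have hBe : 0 ≤ B₀ * Real.exp (δ₀ * ρ) := mul_nonneg hB₀.le (Real.exp_nonneg _)
  set Mbig : ℝ := 2 * N' * (B₀ * Real.exp (δ₀ * ρ) * θ₀) * B6.c1 dE δ₀ α with hMbig
  refine ⟨max (max M₂ M₁) (max Mth Mbig), min a₂ (a₁ / c35), lt_max_of_lt_left (lt_max_of_lt_left hM₂), lt_min ha₂ (div_pos ha₁ hc), ?_⟩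
  intro x
  letI : Fintype (geo9K x.toKIdx).Site := (inferInstance : Fintype (geo9Y x).Site)
  intro hM α₀ hα₀ hMa U hU β' hβ0 hβlt
  have hM₂x : M₂ ≤ (geo9Y x).M := le_trans (le_trans (le_max_left _ _) (le_max_left _ _)) hM
  have hM₁x : M₁ ≤ (geo9Y x).M := le_trans (le_trans (le_max_right _ _) (le_max_left _ _)) hM
  have hMthx : Mth ≤ (geo9Y x).M := le_trans (le_trans (le_max_left _ _) (le_max_right _ _)) hM
  have hMb : Mbig ≤ (geo9Y x).M := le_trans (le_trans (le_max_right _ _) (le_max_right _ _)) hM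
  have hMpos : 0 < (geo9Y x).M := lt_of_lt_of_le hM₁ hM₁x
  have hMa₂ : (geo9Y x).M * α₀ ≤ a₂ := hMa.trans (min_le_left _ _)
  have ha : c35 * (geo9Y x).M * α₀ ≤ a₁ := by
    have h1 : (geo9Y x).M * α₀ ≤ a₁ / c35 := hMa.trans (min_le_right _ _)
    have h2 : (geo9Y x).M * α₀ * c35 ≤ a₁ := (le_div_iff₀ hc).mp h1
    calc c35 * (geo9Y x).M * α₀ = (geo9Y x).M * α₀ * c35 := by ring
      _ ≤ a₁ := h2
  -- the leaf: (3.42)'s four sup majorants of the sum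
  have hconvU : Conv342 (𝔬 x) 1 (H x) C δ U := hconv x U (h37 x hM₂x α₀ hα₀ hMa₂ U hU)
  obtain ⟨-, h1, h2, -⟩ := hconvU
  -- the local inputs and the smallness
  obtain ⟨hl, hT, hid, hLg, hV⟩ := hop x hM₁x α₀ hα₀ ha U hU
  have hq : N' * (B₀ * Real.exp (δ₀ * ρ) * ((κS x).kP + (κS x).kC)) * B6.c1 dE δ₀ α ≤ 1 / 2 :=
    small_of_size_pair hN' hBe hc1 hMpos (hκ x).row (by rw [hMbig] at hMb; exact hMb)
  -- n06-k's left Hölder member of the sum at the (near) site probes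
  have hH := (holder343_of_local37_dir (𝔬 x) (𝔡 x) (𝔩 x) (𝔭 x) 1 (H x) dE δ₀ α ρ B₀ Nn N' Cℓ NH C δ (κS x) (SH x) Bl BV U hB₀.le hδ₀.le hα.le
    (by linarith) hN' hNH hC hδnn hδle (hst x) (hκ x).nonneg (hcntH x) hBl hBV (h261 x hMthx) hq hl hT hid hLg hV h2 β' hβ0 hβlt).1
  -- read it at the pins: `Φ_SN(parSymY) ∘ (DcoS ∘ GcoS O)` between the site anchors
  have hGeo : GeoOK (geo9K x.toKIdx) := geoOK_geo9Y x
  set hcβ : ℝ := holderConst dE δ₀ α NH N' C (Bl β') (BV β') with hhcβ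
  have hhc0 : 0 ≤ hcβ := by
    rw [hhcβ]; exact holderConst_nonneg' hNH hN' hC (hBl β' hβ0 hβlt) (hBV β' hβ0 hβlt)
  have hL1 : HasMajorantHom (g := toB6 (geo9Y x) 1 (H x)) (blkSK x.toKIdx (sIK x.toKIdx (bI x))) (blkPK (sIK x.toKIdx (bI x)))
      ((holderProbesSN x.toKIdx b (bg x) (cfg x) (parSymY x.toKIdx) (bI x)).ΦX U β' ∘ₗ
        (DcoS x.toKIdx b (bg x) (cfg x) U ∘ₗ GcoS x.toKIdx b (bg x) (cfg x) (O x) U))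
      (fun a a' => (hcβ * Real.exp (-(δ * (geo9Y x).dist a a'))) * (geo9Y x).len a ^ (1 - β') * (geo9Y x).len a' ^ (0 : ℝ)) := by
    have h := hH
    rw [hblk x, h𝔭 x, hD x, hGp x, LinearMap.comp_assoc, B9CoReadingCoordsHolderSNear.blkPY_SN,
      B9CoReadingCoordsHolderSNear.ΦY_SN_eq_ΦX_SN] at h
    refine hasMajorantHom_mono (g := toB6 (geo9Y x) 1 (H x)) _ _ h fun a a' => le_of_eq ?_
    rw [Real.rpow_zero, mul_one, hhcβ]; ring
  have hpr := hasMaj_cNormR_of_hasMajorantHom (R₀ := 1) (H₀ := H x) hGeo (C := fun a a' => hcβ * Real.exp (-(δ * (geo9Y x).dist a a')))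
    (fun a a' => mul_nonneg hhc0 (Real.exp_nonneg _)) (1 - β') 0 hL1
  rw [neg_sub] at hpr
  -- the sup member of `∇_U G′` in the `𝔠` classes
  have hS1 : HasMajorantHom (g := toB6 (geo9Y x) 1 (H x)) (blkSK x.toKIdx (sIK x.toKIdx (bI x))) (blkSK x.toKIdx (sIK x.toKIdx (bI x)))
      (DcoS x.toKIdx b (bg x) (cfg x) U ∘ₗ GcoS x.toKIdx b (bg x) (cfg x) (O x) U)
      (fun a a' => (C * Real.exp (-(δ * (geo9Y x).dist a a'))) * (geo9Y x).len a ^ (1 : ℝ) * (geo9Y x).len a' ^ (0 : ℝ)) := by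
    have h := h1
    rw [hblk x, hblkY x, hD x, hGp x] at h
    refine hasMajorantHom_mono (g := toB6 (geo9Y x) 1 (H x)) _ _ h fun a a' => le_of_eq ?_
    rw [Real.rpow_zero, Real.rpow_one]; ring
  have hsup := hasMaj_cNormR_of_hasMajorantHom (R₀ := 1) (H₀ := H x) hGeo (C := fun a a' => C * Real.exp (-(δ * (geo9Y x).dist a a')))
    (fun a a' => mul_nonneg hC (Real.exp_nonneg _)) 1 0 hS1
  -- print's class and unitarity
  have hreg := hP x α₀ U hU
  have hMα : 0 ≤ (kGeo x.toKIdx).M * α₀ := by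
    have : (kGeo x.toKIdx).M = (geo9Y x).M := rfl
    rw [this]; exact (mul_pos hMpos hα₀).le
  have hU : ∀ μ s, UnitaryLike (cfg x U μ s) := fun μ s =>
    B9SectBGpLettersY.norm_le_one_and_inv_of_mem G hG1 (B9BackgroundsKLevelV1P.mem_of_reg335P x.toKIdx hreg μ s)
  -- transporter change `parSymY → parSY` and the probe carrier bridge
  have hβ2 : β' ≤ 2 := by linarith
  have htr := hasMaj_probesSN_parSY_of_parSymY x.toKIdx b hGeo (cfg x) U hc10 hMα hreg hG1 (hlev x) (hβ1 x) (hcf x) hβ0 hβ2 hC hhc0 hδnn hsup hpr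
  have hL1' : (1 : ℝ) ≤ (kGeo x.toKIdx).L := B9Eq335PlaquetteAtLettersY.one_le_L x.toKIdx
  have hcb : 0 ≤ coordBound39 b := by unfold coordBound39; exact norm_nonneg _
  have hbb : 0 ≤ basisBound39 b := Finset.sum_nonneg fun _ _ => norm_nonneg _
  have hCt : 0 ≤ hcβ + 2 * coordBound39 b * basisBound39 b * ((ℓ : ℝ) + 1) * Real.exp (δ * (((d : ℝ) + 1) * (((ℓ : ℝ) + 1) + 1) + 2)) *
      ((((d + 1 : ℕ) : ℝ)) ^ 2 * (2 * (10 * (kGeo x.toKIdx).L * ((kGeo x.toKIdx).M * α₀)) * (1 + 10 * (kGeo x.toKIdx).L * ((kGeo x.toKIdx).M * α₀)) *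
        Real.exp (4 * (10 * (kGeo x.toKIdx).L * ((kGeo x.toKIdx).M * α₀)))) * (kGeo x.toKIdx).L ^ 6) * C +
      coordBound39 b * basisBound39 b * C + C := by positivity
  have hbr := hasMaj_probesKA_DvGcoS_of_probesSN x.toKIdx b (cfg x) (O x) U hGeo hU (hlev x) (hbI0 x) (hcf x) hC hCt htr hsup
  -- the constant: `K_pl(M α₀) ≤ K_pl(a₀)`
  refine hbr.mono fun a a' => ?_
  have hMa0 : (kGeo x.toKIdx).M * α₀ ≤ min a₂ (a₁ / c35) := hMa
  have hK : 10 * (kGeo x.toKIdx).L * ((kGeo x.toKIdx).M * α₀) ≤ 10 * (kGeo x.toKIdx).L * min a₂ (a₁ / c35) := mul_le_mul_of_nonneg_left hMa0 (by positivity)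
  have hpl := B9Eq335CoveragePAtLettersY.plaqBound_mono (C := 10 * (kGeo x.toKIdx).L * ((kGeo x.toKIdx).M * α₀)) (C' := 10 * (kGeo x.toKIdx).L * min a₂ (a₁ / c35))
    (by positivity) hK
  have hγ1 : |x.toKIdx.cf| * etaS x.toKIdx = 1 := by
    rw [hcf x]; unfold etaS
    exact mul_inv_cancel₀ (nKT_pos (toKT x.toKIdx)).ne'
  have hE0 := Real.exp_nonneg (-(δ * (geo9K x.toKIdx).dist a a'))
  have hfac : 0 ≤ 2 * coordBound39 b * basisBound39 b * ((ℓ : ℝ) + 1) * Real.exp (δ * (((d : ℝ) + 1) * (((ℓ : ℝ) + 1) + 1) + 2)) := by positivity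
  have hmid : (((d + 1 : ℕ) : ℝ)) ^ 2 * (2 * (10 * (kGeo x.toKIdx).L * ((kGeo x.toKIdx).M * α₀)) * (1 + 10 * (kGeo x.toKIdx).L * ((kGeo x.toKIdx).M * α₀)) *
        Real.exp (4 * (10 * (kGeo x.toKIdx).L * ((kGeo x.toKIdx).M * α₀)))) * (kGeo x.toKIdx).L ^ 6 ≤
      (((d + 1 : ℕ) : ℝ)) ^ 2 * (2 * (10 * (kGeo x.toKIdx).L * min a₂ (a₁ / c35)) * (1 + 10 * (kGeo x.toKIdx).L * min a₂ (a₁ / c35)) *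
        Real.exp (4 * (10 * (kGeo x.toKIdx).L * min a₂ (a₁ / c35)))) * (kGeo x.toKIdx).L ^ 6 :=
    mul_le_mul_of_nonneg_right (mul_le_mul_of_nonneg_left hpl (by positivity)) (by positivity)
  have hbig : (hcβ + 2 * coordBound39 b * basisBound39 b * ((ℓ : ℝ) + 1) * Real.exp (δ * (((d : ℝ) + 1) * (((ℓ : ℝ) + 1) + 1) + 2)) *
            ((((d + 1 : ℕ) : ℝ)) ^ 2 * (2 * (10 * (kGeo x.toKIdx).L * ((kGeo x.toKIdx).M * α₀)) * (1 + 10 * (kGeo x.toKIdx).L * ((kGeo x.toKIdx).M * α₀)) *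
              Real.exp (4 * (10 * (kGeo x.toKIdx).L * ((kGeo x.toKIdx).M * α₀)))) * (kGeo x.toKIdx).L ^ 6) * C +
          coordBound39 b * basisBound39 b * C + C) + C + coordBound39 b * basisBound39 b * C ≤
      (hcβ + 2 * coordBound39 b * basisBound39 b * ((ℓ : ℝ) + 1) * Real.exp (δ * (((d : ℝ) + 1) * (((ℓ : ℝ) + 1) + 1) + 2)) *
            ((((d + 1 : ℕ) : ℝ)) ^ 2 * (2 * (10 * (kGeo x.toKIdx).L * min a₂ (a₁ / c35)) * (1 + 10 * (kGeo x.toKIdx).L * min a₂ (a₁ / c35)) *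
              Real.exp (4 * (10 * (kGeo x.toKIdx).L * min a₂ (a₁ / c35)))) * (kGeo x.toKIdx).L ^ 6) * C +
          coordBound39 b * basisBound39 b * C + C) + C + coordBound39 b * basisBound39 b * C := by
    have := mul_le_mul_of_nonneg_right (mul_le_mul_of_nonneg_left hmid hfac) hC
    linarith
  rw [hγ1, one_mul]
  exact mul_le_mul_of_nonneg_right hbig hE0

/-- ★★★ **THE SAME WITH AN `a₀`-UNIFORM CONSTANT** (dag-n06-d g20's consumer finding (c), 2026-08-29: the certificate's `BhW : ℝ → ℝ` is displayed DATA, so the ∃-bound threshold `a₀`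
may not enter it): `K_pl` is read at the DISPLAYED cap `a₁ ∕ c` (`M·α₀ ≤ a₀ ≤ a₁∕c` in the regime), everything else verbatim; constant `BhW(a₁∕c, β′)`. [cite: Balaban1985BackgroundPropagators, Thm 3.7 p.409 + «Theorem 3.7 implies (3.42)–(3.47)» p.410 + (3.43) p.398 + (3.40) p.397 + (3.35) p.396] -/
theorem hpDGW_of_thm37PrintedSN_unif {G : Subgroup (Matrix (Fin N) (Fin N) ℂ)ˣ} (hG1 : ∀ u : (Matrix (Fin N) (Fin N) ℂ)ˣ, u ∈ G → ‖(u : Matrix (Fin N) (Fin N) ℂ)‖ ≤ 1)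
    {bg : MemberY d ℓ hd hL b₀ b₁ Mstar → B9.Backgrounds} (cfg : ∀ x : MemberY d ℓ hd hL b₀ b₁ Mstar, (bg x).Cfg → CfgY (Matrix (Fin N) (Fin N) ℂ) x.toKIdx)
    (b : Module.Basis κ ℝ (Matrix (Fin N) (Fin N) ℂ)) {c35 c10 : ℝ} (hc10 : c10 ≤ 10)
    (hP : ∀ (x : MemberY d ℓ hd hL b₀ b₁ Mstar) (α₀ : ℝ) (U : (bg x).Cfg), (bg x).Reg335 c35 α₀ U →
      (bg9KP (Matrix (Fin N) (Fin N) ℂ) G x.toKIdx).Reg335 c10 α₀ (cfg x U))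
    {ι Q : MemberY d ℓ hd hL b₀ b₁ Mstar → Type} [∀ x, Fintype (ι x)] [∀ x, Fintype (Q x)]
    (𝔬 : ∀ x : MemberY d ℓ hd hL b₀ b₁ Mstar, Ops (geo9Y x) (bg x) (XSK κ x.toKIdx) (XSK κ x.toKIdx) (ι x))
    (𝔡 : ∀ x : MemberY d ℓ hd hL b₀ b₁ Mstar, DirOps37 (𝔬 x) (Q x)) (𝔩 : ∀ x : MemberY d ℓ hd hL b₀ b₁ Mstar, DirLetters37 (𝔬 x) (Q x))
    (𝔭 : ∀ x : MemberY d ℓ hd hL b₀ b₁ Mstar,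
      HolderProbes (geo9Y x) (bg x) (XSK κ x.toKIdx) (XSK κ x.toKIdx) (PK (SiteY x.toKIdx) (Fin (d + 1)) κ) (PK (SiteY x.toKIdx) (Fin (d + 1)) κ))
    (H : MemberY d ℓ hd hL b₀ b₁ Mstar → Prop) (O : ∀ x : MemberY d ℓ hd hL b₀ b₁ Mstar, SiteOpY (Matrix (Fin N) (Fin N) ℂ) x.toKIdx)
    {bI : ∀ x : MemberY d ℓ hd hL b₀ b₁ Mstar, FBondY x.toKIdx → IBondY x.toKIdx}
    (hlev : ∀ (x : MemberY d ℓ hd hL b₀ b₁ Mstar) (f : FBondY x.toKIdx), lvl x.toKIdx.hN x.toKIdx.D x.toKIdx.hk (bI x f) = (blkV1 x.toKIdx.hN x.toKIdx.D f).1.1)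
    (hβ1 : ∀ (x : MemberY d ℓ hd hL b₀ b₁ Mstar) (f : FBondY x.toKIdx),
      (geomT x.toKIdx.D).dist (β x.toKIdx.hN x.toKIdx.D x.toKIdx.hk (bI x f)) (blkV1 x.toKIdx.hN x.toKIdx.D f) ≤ 1)
    (hbI0 : ∀ (x : MemberY d ℓ hd hL b₀ b₁ Mstar) (f : FBondY x.toKIdx), bI x f = bI x ⟨f.src, 0⟩)
    (hcf : ∀ x : MemberY d ℓ hd hL b₀ b₁ Mstar, |x.toKIdx.cf| = (nKT (toKT x.toKIdx) : ℝ))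
    (h𝔭 : ∀ x : MemberY d ℓ hd hL b₀ b₁ Mstar, 𝔭 x = holderProbesSN x.toKIdx b (bg x) (cfg x) (parSymY x.toKIdx) (bI x))
    (hblk : ∀ x : MemberY d ℓ hd hL b₀ b₁ Mstar, (𝔬 x).blk = blkSK x.toKIdx (sIK x.toKIdx (bI x)))
    (hblkY : ∀ x : MemberY d ℓ hd hL b₀ b₁ Mstar, (𝔬 x).blkY = blkSK x.toKIdx (sIK x.toKIdx (bI x)))
    (hGp : ∀ (x : MemberY d ℓ hd hL b₀ b₁ Mstar) (U : (bg x).Cfg), (𝔬 x).Gp U = GcoS x.toKIdx b (bg x) (cfg x) (O x) U)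
    (hD : ∀ (x : MemberY d ℓ hd hL b₀ b₁ Mstar) (U : (bg x).Cfg), (𝔬 x).D U = DcoS x.toKIdx b (bg x) (cfg x) U)
    (κS : MemberY d ℓ hd hL b₀ b₁ Mstar → Sizes) (SH : ∀ x : MemberY d ℓ hd hL b₀ b₁ Mstar, ι x → Finset (geo9Y x).Site)
    {α ρ Nn N' Cℓ Kc θ₀ B₀ δ₀ a₁ M₁ NH αF C δ : ℝ} (Bl BV : ℝ → ℝ)
    (hc : 0 < c35) (hα : 0 < α) (hα2 : α < 1 / 2) (hN' : 0 ≤ N') (hNH : 0 ≤ NH) (hB₀ : 0 < B₀) (hδ₀ : 0 < δ₀) (ha₁ : 0 < a₁) (hM₁ : 0 < M₁)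
    (hαF : 0 < αF) (hαF1 : αF < 1) (hC : 0 ≤ C) (hδnn : 0 ≤ δ) (hδle : δ ≤ (1 - α) * δ₀)
    (hBl : ∀ β', 0 ≤ β' → β' < 1 → 0 ≤ Bl β') (hBV : ∀ β', 0 ≤ β' → β' < 1 → 0 ≤ BV β')
    (hst : ∀ x, StaticOK (𝔬 x) ρ Nn N' Cℓ (κS x)) (hκ : ∀ x, (κS x).Bounded Kc θ₀ Cℓ (geo9Y x).M)
    (hcntH : ∀ x (a : (geo9Y x).Site), (∑ q, if a ∈ SH x q then (1 : ℝ) else 0) ≤ NH)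
    (hop : ∀ x, M₁ ≤ (geo9Y x).M → ∀ α₀ : ℝ, 0 < α₀ → c35 * (geo9Y x).M * α₀ ≤ a₁ →
      ∀ U : (bg x).Cfg, (bg x).Reg335 c35 α₀ U →
        Local342 (𝔬 x) 1 (H x) B₀ δ₀ U ∧ DirSupSq37 (𝔬 x) (𝔡 x) 1 (H x) U ∧ Identities₂ (𝔬 x) (𝔡 x) (𝔩 x) 1 (H x) U ∧
          HolderLegs37 (𝔬 x) (𝔭 x) 1 (H x) (SH x) Bl δ₀ U ∧ HolderV37Dir (𝔬 x) (𝔡 x) (𝔩 x) (𝔭 x) 1 (H x) BV δ₀ U)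
    (E : ∀ x : MemberY d ℓ hd hL b₀ b₁ Mstar, B9.RWExpansion (geo9Y x) (bg x)) (t37 : B9.Thm37Printed c35 (fun x => geo9Y x) bg E)
    (hconv : ∀ (x : MemberY d ℓ hd hL b₀ b₁ Mstar) (U : (bg x).Cfg), (E x).Converges U → Conv342 (𝔬 x) 1 (H x) C δ U) :
    ∃ M₂ a₀ : ℝ, 0 < M₂ ∧ 0 < a₀ ∧
      ∀ x : MemberY d ℓ hd hL b₀ b₁ Mstar, letI : Fintype (geo9K x.toKIdx).Site := (inferInstance : Fintype (geo9Y x).Site)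
        M₂ ≤ (geo9Y x).M → ∀ α₀ : ℝ, 0 < α₀ → (geo9Y x).M * α₀ ≤ a₀ →
        ∀ U : (bg x).Cfg, (bg x).Reg335 c35 α₀ U → ∀ β' : ℝ, 0 ≤ β' → β' < 1 →
          HasMaj (cNormR 1 (H x) (blkSK x.toKIdx (sIK x.toKIdx (bI x))) (geoOK_geo9Y x).lenle 0)
            (cNormR 1 (H x) (blkPK (bI x)) (geoOK_geo9Y x).lenle (β' - 1))
            ((holderProbesKA x.toKIdx b (bg x) (cfg x) (parBY x.toKIdx) (bI x)).ΦX U β' ∘ₗ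
              (DvcoKH x.toKIdx b (bg x) (cfg x) U ∘ₗ GcoS x.toKIdx b (bg x) (cfg x) (O x) U))
            (fun a a' =>
              ((holderConst (exp261 (@geo9Y d ℓ hd hL b₀ b₁ Mstar) δ₀ α) δ₀ α NH N' C (Bl β') (BV β') +
                  2 * coordBound39 b * basisBound39 b * ((ℓ : ℝ) + 1) * Real.exp (δ * (((d : ℝ) + 1) * (((ℓ : ℝ) + 1) + 1) + 2)) *
                    ((((d + 1 : ℕ) : ℝ)) ^ 2 * (2 * (10 * ((ℓ + 1 : ℕ) : ℝ) * (a₁ / c35)) * (1 + 10 * ((ℓ + 1 : ℕ) : ℝ) * (a₁ / c35)) *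
                      Real.exp (4 * (10 * ((ℓ + 1 : ℕ) : ℝ) * (a₁ / c35)))) * ((ℓ + 1 : ℕ) : ℝ) ^ 6) * C +
                  coordBound39 b * basisBound39 b * C + C) + C + coordBound39 b * basisBound39 b * C) *
              Real.exp (-(δ * (geo9Y x).dist a a'))) := by
  classical
  -- the leaf's thresholds and the record's (2.61) threshold
  obtain ⟨M₂, a₂, hM₂, ha₂, h37⟩ := t37
  obtain ⟨Mth, h261, -, -⟩ := lemma21Pack_geo9Y (d := d) (ℓ := ℓ) (hd := hd) (hL := hL) (b₀ := b₀) (b₁ := b₁) (Mstar := Mstar) H hα hα2 hδ₀ hαF hαF1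
  set dE : ℕ := exp261 (@geo9Y d ℓ hd hL b₀ b₁ Mstar) δ₀ α with hdE
  have hc1 : 0 ≤ B6.c1 dE δ₀ α := c1_nonneg dE δ₀ α
  have hBe : 0 ≤ B₀ * Real.exp (δ₀ * ρ) := mul_nonneg hB₀.le (Real.exp_nonneg _)
  set Mbig : ℝ := 2 * N' * (B₀ * Real.exp (δ₀ * ρ) * θ₀) * B6.c1 dE δ₀ α with hMbig
  refine ⟨max (max M₂ M₁) (max Mth Mbig), min a₂ (a₁ / c35), lt_max_of_lt_left (lt_max_of_lt_left hM₂), lt_min ha₂ (div_pos ha₁ hc), ?_⟩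
  intro x
  letI : Fintype (geo9K x.toKIdx).Site := (inferInstance : Fintype (geo9Y x).Site)
  intro hM α₀ hα₀ hMa U hU β' hβ0 hβlt
  have hM₂x : M₂ ≤ (geo9Y x).M := le_trans (le_trans (le_max_left _ _) (le_max_left _ _)) hM
  have hM₁x : M₁ ≤ (geo9Y x).M := le_trans (le_trans (le_max_right _ _) (le_max_left _ _)) hM
  have hMthx : Mth ≤ (geo9Y x).M := le_trans (le_trans (le_max_left _ _) (le_max_right _ _)) hM
  have hMb : Mbig ≤ (geo9Y x).M := le_trans (le_trans (le_max_right _ _) (le_max_right _ _)) hM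
  have hMpos : 0 < (geo9Y x).M := lt_of_lt_of_le hM₁ hM₁x
  have hMa₂ : (geo9Y x).M * α₀ ≤ a₂ := hMa.trans (min_le_left _ _)
  have ha : c35 * (geo9Y x).M * α₀ ≤ a₁ := by
    have h1 : (geo9Y x).M * α₀ ≤ a₁ / c35 := hMa.trans (min_le_right _ _)
    have h2 : (geo9Y x).M * α₀ * c35 ≤ a₁ := (le_div_iff₀ hc).mp h1
    calc c35 * (geo9Y x).M * α₀ = (geo9Y x).M * α₀ * c35 := by ring
      _ ≤ a₁ := h2
  -- the leaf: (3.42)'s four sup majorants of the sum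
  have hconvU : Conv342 (𝔬 x) 1 (H x) C δ U := hconv x U (h37 x hM₂x α₀ hα₀ hMa₂ U hU)
  obtain ⟨-, h1, h2, -⟩ := hconvU
  -- the local inputs and the smallness
  obtain ⟨hl, hT, hid, hLg, hV⟩ := hop x hM₁x α₀ hα₀ ha U hU
  have hq : N' * (B₀ * Real.exp (δ₀ * ρ) * ((κS x).kP + (κS x).kC)) * B6.c1 dE δ₀ α ≤ 1 / 2 :=
    small_of_size_pair hN' hBe hc1 hMpos (hκ x).row (by rw [hMbig] at hMb; exact hMb)
  -- n06-k's left Hölder member of the sum at the (near) site probes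
  have hH := (holder343_of_local37_dir (𝔬 x) (𝔡 x) (𝔩 x) (𝔭 x) 1 (H x) dE δ₀ α ρ B₀ Nn N' Cℓ NH C δ (κS x) (SH x) Bl BV U hB₀.le hδ₀.le hα.le
    (by linarith) hN' hNH hC hδnn hδle (hst x) (hκ x).nonneg (hcntH x) hBl hBV (h261 x hMthx) hq hl hT hid hLg hV h2 β' hβ0 hβlt).1
  -- read it at the pins: `Φ_SN(parSymY) ∘ (DcoS ∘ GcoS O)` between the site anchors
  have hGeo : GeoOK (geo9K x.toKIdx) := geoOK_geo9Y x
  set hcβ : ℝ := holderConst dE δ₀ α NH N' C (Bl β') (BV β') with hhcβ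
  have hhc0 : 0 ≤ hcβ := by
    rw [hhcβ]; exact holderConst_nonneg' hNH hN' hC (hBl β' hβ0 hβlt) (hBV β' hβ0 hβlt)
  have hL1 : HasMajorantHom (g := toB6 (geo9Y x) 1 (H x)) (blkSK x.toKIdx (sIK x.toKIdx (bI x))) (blkPK (sIK x.toKIdx (bI x)))
      ((holderProbesSN x.toKIdx b (bg x) (cfg x) (parSymY x.toKIdx) (bI x)).ΦX U β' ∘ₗ
        (DcoS x.toKIdx b (bg x) (cfg x) U ∘ₗ GcoS x.toKIdx b (bg x) (cfg x) (O x) U))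
      (fun a a' => (hcβ * Real.exp (-(δ * (geo9Y x).dist a a'))) * (geo9Y x).len a ^ (1 - β') * (geo9Y x).len a' ^ (0 : ℝ)) := by
    have h := hH
    rw [hblk x, h𝔭 x, hD x, hGp x, LinearMap.comp_assoc, B9CoReadingCoordsHolderSNear.blkPY_SN,
      B9CoReadingCoordsHolderSNear.ΦY_SN_eq_ΦX_SN] at h
    refine hasMajorantHom_mono (g := toB6 (geo9Y x) 1 (H x)) _ _ h fun a a' => le_of_eq ?_
    rw [Real.rpow_zero, mul_one, hhcβ]; ring
  have hpr := hasMaj_cNormR_of_hasMajorantHom (R₀ := 1) (H₀ := H x) hGeo (C := fun a a' => hcβ * Real.exp (-(δ * (geo9Y x).dist a a')))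
    (fun a a' => mul_nonneg hhc0 (Real.exp_nonneg _)) (1 - β') 0 hL1
  rw [neg_sub] at hpr
  -- the sup member of `∇_U G′` in the `𝔠` classes
  have hS1 : HasMajorantHom (g := toB6 (geo9Y x) 1 (H x)) (blkSK x.toKIdx (sIK x.toKIdx (bI x))) (blkSK x.toKIdx (sIK x.toKIdx (bI x)))
      (DcoS x.toKIdx b (bg x) (cfg x) U ∘ₗ GcoS x.toKIdx b (bg x) (cfg x) (O x) U)
      (fun a a' => (C * Real.exp (-(δ * (geo9Y x).dist a a'))) * (geo9Y x).len a ^ (1 : ℝ) * (geo9Y x).len a' ^ (0 : ℝ)) := by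
    have h := h1
    rw [hblk x, hblkY x, hD x, hGp x] at h
    refine hasMajorantHom_mono (g := toB6 (geo9Y x) 1 (H x)) _ _ h fun a a' => le_of_eq ?_
    rw [Real.rpow_zero, Real.rpow_one]; ring
  have hsup := hasMaj_cNormR_of_hasMajorantHom (R₀ := 1) (H₀ := H x) hGeo (C := fun a a' => C * Real.exp (-(δ * (geo9Y x).dist a a')))
    (fun a a' => mul_nonneg hC (Real.exp_nonneg _)) 1 0 hS1
  -- print's class and unitarity
  have hreg := hP x α₀ U hU
  have hMα : 0 ≤ (kGeo x.toKIdx).M * α₀ := by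
    have : (kGeo x.toKIdx).M = (geo9Y x).M := rfl
    rw [this]; exact (mul_pos hMpos hα₀).le
  have hU : ∀ μ s, UnitaryLike (cfg x U μ s) := fun μ s =>
    B9SectBGpLettersY.norm_le_one_and_inv_of_mem G hG1 (B9BackgroundsKLevelV1P.mem_of_reg335P x.toKIdx hreg μ s)
  -- transporter change `parSymY → parSY` and the probe carrier bridge
  have hβ2 : β' ≤ 2 := by linarith
  have htr := hasMaj_probesSN_parSY_of_parSymY x.toKIdx b hGeo (cfg x) U hc10 hMα hreg hG1 (hlev x) (hβ1 x) (hcf x) hβ0 hβ2 hC hhc0 hδnn hsup hpr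
  have hL1' : (1 : ℝ) ≤ (kGeo x.toKIdx).L := B9Eq335PlaquetteAtLettersY.one_le_L x.toKIdx
  have hcb : 0 ≤ coordBound39 b := by unfold coordBound39; exact norm_nonneg _
  have hbb : 0 ≤ basisBound39 b := Finset.sum_nonneg fun _ _ => norm_nonneg _
  have hCt : 0 ≤ hcβ + 2 * coordBound39 b * basisBound39 b * ((ℓ : ℝ) + 1) * Real.exp (δ * (((d : ℝ) + 1) * (((ℓ : ℝ) + 1) + 1) + 2)) *
      ((((d + 1 : ℕ) : ℝ)) ^ 2 * (2 * (10 * (kGeo x.toKIdx).L * ((kGeo x.toKIdx).M * α₀)) * (1 + 10 * (kGeo x.toKIdx).L * ((kGeo x.toKIdx).M * α₀)) *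
        Real.exp (4 * (10 * (kGeo x.toKIdx).L * ((kGeo x.toKIdx).M * α₀)))) * (kGeo x.toKIdx).L ^ 6) * C +
      coordBound39 b * basisBound39 b * C + C := by positivity
  have hbr := hasMaj_probesKA_DvGcoS_of_probesSN x.toKIdx b (cfg x) (O x) U hGeo hU (hlev x) (hbI0 x) (hcf x) hC hCt htr hsup
  -- the constant: `K_pl(M α₀) ≤ K_pl(a₀)`
  refine hbr.mono fun a a' => ?_
  have hMa0 : (kGeo x.toKIdx).M * α₀ ≤ a₁ / c35 := hMa.trans (min_le_right _ _)
  have hK : 10 * (kGeo x.toKIdx).L * ((kGeo x.toKIdx).M * α₀) ≤ 10 * (kGeo x.toKIdx).L * (a₁ / c35) := mul_le_mul_of_nonneg_left hMa0 (by positivity)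
  have hpl := B9Eq335CoveragePAtLettersY.plaqBound_mono (C := 10 * (kGeo x.toKIdx).L * ((kGeo x.toKIdx).M * α₀)) (C' := 10 * (kGeo x.toKIdx).L * (a₁ / c35))
    (by positivity) hK
  have hγ1 : |x.toKIdx.cf| * etaS x.toKIdx = 1 := by
    rw [hcf x]; unfold etaS
    exact mul_inv_cancel₀ (nKT_pos (toKT x.toKIdx)).ne'
  have hE0 := Real.exp_nonneg (-(δ * (geo9K x.toKIdx).dist a a'))
  have hfac : 0 ≤ 2 * coordBound39 b * basisBound39 b * ((ℓ : ℝ) + 1) * Real.exp (δ * (((d : ℝ) + 1) * (((ℓ : ℝ) + 1) + 1) + 2)) := by positivity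
  have hmid : (((d + 1 : ℕ) : ℝ)) ^ 2 * (2 * (10 * (kGeo x.toKIdx).L * ((kGeo x.toKIdx).M * α₀)) * (1 + 10 * (kGeo x.toKIdx).L * ((kGeo x.toKIdx).M * α₀)) *
        Real.exp (4 * (10 * (kGeo x.toKIdx).L * ((kGeo x.toKIdx).M * α₀)))) * (kGeo x.toKIdx).L ^ 6 ≤
      (((d + 1 : ℕ) : ℝ)) ^ 2 * (2 * (10 * (kGeo x.toKIdx).L * (a₁ / c35)) * (1 + 10 * (kGeo x.toKIdx).L * (a₁ / c35)) *
        Real.exp (4 * (10 * (kGeo x.toKIdx).L * (a₁ / c35)))) * (kGeo x.toKIdx).L ^ 6 :=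
    mul_le_mul_of_nonneg_right (mul_le_mul_of_nonneg_left hpl (by positivity)) (by positivity)
  have hbig : (hcβ + 2 * coordBound39 b * basisBound39 b * ((ℓ : ℝ) + 1) * Real.exp (δ * (((d : ℝ) + 1) * (((ℓ : ℝ) + 1) + 1) + 2)) *
            ((((d + 1 : ℕ) : ℝ)) ^ 2 * (2 * (10 * (kGeo x.toKIdx).L * ((kGeo x.toKIdx).M * α₀)) * (1 + 10 * (kGeo x.toKIdx).L * ((kGeo x.toKIdx).M * α₀)) *
              Real.exp (4 * (10 * (kGeo x.toKIdx).L * ((kGeo x.toKIdx).M * α₀)))) * (kGeo x.toKIdx).L ^ 6) * C +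
          coordBound39 b * basisBound39 b * C + C) + C + coordBound39 b * basisBound39 b * C ≤
      (hcβ + 2 * coordBound39 b * basisBound39 b * ((ℓ : ℝ) + 1) * Real.exp (δ * (((d : ℝ) + 1) * (((ℓ : ℝ) + 1) + 1) + 2)) *
            ((((d + 1 : ℕ) : ℝ)) ^ 2 * (2 * (10 * (kGeo x.toKIdx).L * (a₁ / c35)) * (1 + 10 * (kGeo x.toKIdx).L * (a₁ / c35)) *
              Real.exp (4 * (10 * (kGeo x.toKIdx).L * (a₁ / c35)))) * (kGeo x.toKIdx).L ^ 6) * C +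
          coordBound39 b * basisBound39 b * C + C) + C + coordBound39 b * basisBound39 b * C := by
    have := mul_le_mul_of_nonneg_right (mul_le_mul_of_nonneg_left hmid hfac) hC
    linarith
  rw [hγ1, one_mul]
  exact mul_le_mul_of_nonneg_right hbig hE0

end Literature.MathematicalPhysics.QuantumFieldTheory.Balaban1983to89.B9HpDGWFromPinsSN

end
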